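import Summits.Langlands.Langlands.Theorems.NonParallelVoidTwistedInductionParallelSymmetriseDefs
import Summits.Langlands.Langlands.Theorems.NonParallelVoidGapArithmetic
import Literature.NumberTheory.GaloisRepresentations.PinnedDatumLabels
import Literature.NumberTheory.Automorphic.Qian2022HLTTConj
import Literature.NumberTheory.Automorphic.AHTW2026ExactWeights
import Literature.NumberTheory.PAdicHodge.FontainePstLabelledWeightsSchemata
import Literature.NumberTheory.Automorphic.ClozelPurityProofs
import Literature.NumberTheory.GaloisRepresentations.FramedRepTwistTraceLocalProofs
import Literature.NumberTheory.GaloisRepresentations.CrystallineDeformationRing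
import HarnessLib

/-!
# Route `NonParallelVoid`, crux `TwistedInductionParallel` (stmt-Langlands-17000), line `symmetrise-pd-split`:
# stub 4 `stub_parallelOfAutomorphicTwist` (skeleton v4/v5 registered signature) — an automorphic algebraic
# twist over a CM field forces parallel gaps

Proof by the wave-1 stub worker of the lead prover-line-stmt-Langlands-17000-0 (2026-08-17), with its four
in-print inputs as LEADING HYPOTHESES (all LANDED named facts): Harris–Lan–Taylor–Thorne Thm. A
(`HarrisLanTaylorThorne2016.theoremA_existence`), A'Campo–Hevesi–Thorne–Whitmore Thm. 1.2.1 exact labelled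
weights for the pinned data (`AHTW2026.labelledHodgeTateWeights_eq`, p168501) and the two pinned-data
labelled-weights schemata (`LabelledWeightsRestrictSchema`, `LabelledWeightsTwistSchema`, p168511).  Clozel's
purity lemma, Chebotarev density and Brauer–Nesbitt are PROVED theorems of the tree.  Waypoint in the v4
typing `AutomorphicTwistOverCMHT` (the twisting character is only asked to be Hodge–Tate-algebraic — de Rham
with one labelled weight — which is all the proof consumes).

Paper proof: `r := ρ|_{E'} ⊗ χ'` is conjugate to an HLTT-compatible `r'` (landed bridge
`Qian2022.IsAutomorphic.exists_hltt_conj`), whose labelled weights at a label `(w, τ)` of `E'` are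
`{1/2 − a : a ∈ A(T, ι ∘ τ)}` (AHTW); at the CONJUGATE label the embedding is `conj ∘ (ι ∘ τ)` (`E'` CM),
where Clozel purity reflects the `a`-multiset through `x ↦ w₀ − x`; the weights of `r` at `(w, τ)` are
those of `ρ` at the label of `F` below, shifted by the weight of `χ'`; so the labels of `F` below `(w, τ)`
and below its conjugate have EQUAL gaps and conjugate, hence DISTINCT, global embeddings (`F` totally
complex); a quadratic `F` has two embeddings into `ℚ̄_p` and a label is determined by its embedding
(`PinnedDatumLabels`, p168050), so every label of `F` has that gap.  No hypothesis on the splitting of `p`.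
Census: crux workfiles / lead folder `work/stubs/StubParallelOfAutomorphicTwist-census.md`.
-/

noncomputable section

open scoped NumberField
open NumberField IsDedekindDomain Field Filter ValuativeRel
open Literature.NumberTheory.GaloisRepresentations Literature.NumberTheory.PAdicHodge
open Literature.NumberTheory.Automorphic

-- `Summit.Langlands.Langlands.…` repeats a namespace component by design (D-0017 nested layout).
set_option linter.dupNamespace false

namespace Summit.Langlands.Langlands.Cruxes.TwistedInductionParallel.SymmetrisePdSplit


/-! The three named facts of §0 (wave 1) are LANDED under Literature and imported:
`AHTW2026.labelledHodgeTateWeights_eq` (`Automorphic/AHTW2026ExactWeights.lean`, p168501),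
`LabelledWeightsRestrictSchema`, `LabelledWeightsTwistSchema`
(`PAdicHodge/FontainePstLabelledWeightsSchemata.lean`, p168511). -/


/-! ## 2. The weights of `ρ|_{E'} ⊗ χ'` at a label of `E'` (from the two schemata) -/

section Below

variable {F E' : Type} [Field F] [NumberField F] [Field E'] [NumberField E'] [Algebra F E']
  {p : ℕ} [Fact p.Prime]

/-- **The weights of `ρ|_{E'} ⊗ χ'` at a label of `E'` are the weights of `ρ` at the label of `F`
below, shifted by the weight of `χ'` there** — from the two pinned-data schemata (restriction, label
by label, through `exists_toLocal_restrictField_eq_conj` and frame invariance; twist).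
[cite: Patrikis2019, §2.7.1] [cite: FontaineAsterisque223III, Exp. III §1.5] -/
theorem labelledHodgeTateWeightsAtLabel_twist_restrictField (hS1 : LabelledWeightsRestrictSchema)
    (hS2 : LabelledWeightsTwistSchema) {n : ℕ} (ρ : FramedGaloisRep F (PadicAlgCl p) n)
    (χ : absoluteGaloisGroup E' →ₜ* (PadicAlgCl p)ˣ) {w : HeightOneSpectrum (𝓞 E')}
    {hw : ((p : ℕ) : 𝓞 E') ∈ w.asIdeal} (τ : PinnedLabel p w hw) (k : ℤ)
    (hχdR : (fontainePstAdicCompletion w p hw).IsDeRhamFramed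
      (FramedGaloisRep.toLocal w
        ((FramedRep.scalar (PadicAlgCl p) 1).comp χ :
          FramedGaloisRep E' (PadicAlgCl p) 1)))
    (hχk : labelledHodgeTateWeightsAtLabel
      ((FramedRep.scalar (PadicAlgCl p) 1).comp χ : FramedGaloisRep E' (PadicAlgCl p) 1) w hw τ = {k}) :
    labelledHodgeTateWeightsAtLabel (FramedRep.twist (ρ.restrictField E') χ) w hw τ =
      (labelledHodgeTateWeightsAtLabel ρ (w.under (𝓞 F)) (natCast_mem_under (F := F) hw)
        (τ.below F)).map fun h => h + k := by
  haveI := LocalField.charZero_adicCompletion w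
  haveI := LocalField.charZero_adicCompletion (w.under (𝓞 F))
  haveI := liesOver_under (F := F) w
  rw [FramedGaloisRep.toLocal_scalar_comp] at hχdR
  simp only [labelledHodgeTateWeightsAtLabel, FramedGaloisRep.labelledHodgeTateWeightsAt_def] at hχk
  rw [FramedGaloisRep.toLocal_scalar_comp] at hχk
  -- twist
  have h1 : labelledHodgeTateWeightsAtLabel (FramedRep.twist (ρ.restrictField E') χ) w hw τ =
      (labelledHodgeTateWeightsAtLabel (ρ.restrictField E') w hw τ).map fun h => h + k := by
    simp only [labelledHodgeTateWeightsAtLabel, FramedGaloisRep.labelledHodgeTateWeightsAt_def,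
      FramedGaloisRep.toLocal_twist]
    exact hS2 p (w.adicCompletion E') (LocalField.valuation_adicCompletion_natCast_lt_one w p hw) n
      ((ρ.restrictField E').toLocal w) (χ.comp (absGaloisRestrict E' (w.adicCompletion E'))) k hχdR
      τ hχk
  -- restriction
  have h2 : labelledHodgeTateWeightsAtLabel (ρ.restrictField E') w hw τ =
      labelledHodgeTateWeightsAtLabel ρ (w.under (𝓞 F)) (natCast_mem_under (F := F) hw)
        (τ.below F) := by
    letI := (adicCompletionOfLiesOver F E' (w.under (𝓞 F)) w).toAlgebra
    obtain ⟨γ, hγ⟩ := exists_toLocal_restrictField_eq_conj ρ (w.under (𝓞 F)) w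
    simp only [labelledHodgeTateWeightsAtLabel, FramedGaloisRep.labelledHodgeTateWeightsAt_def]
    rw [hγ, PstWeilDeligneData.labelledHodgeTateWeights_conj_eq]
    exact hS1 p ((w.under (𝓞 F)).adicCompletion F) (w.adicCompletion E')
      (continuous_adicCompletionOfLiesOver F E' (w.under (𝓞 F)) w)
      (LocalField.valuation_adicCompletion_natCast_lt_one (w.under (𝓞 F)) p
        (natCast_mem_under (F := F) hw))
      (LocalField.valuation_adicCompletion_natCast_lt_one w p hw) n (ρ.toLocal (w.under (𝓞 F)))
      (τ.below F) τ (PinnedLabel.toHom_below F τ).symm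
  rw [h1, h2]

end Below

/-! ## 3. Arithmetic of the purity reflection, and the two embeddings of a quadratic field -/

section Arithmetic

/-- Entries of equal two-element multisets agree up to order. [folklore] -/
theorem pair_cases {α : Type*} {x y u v : α} (h : (x ::ₘ {y} : Multiset α) = u ::ₘ {v}) :
    (x = u ∧ y = v) ∨ (x = v ∧ y = u) := by
  rw [Multiset.cons_eq_cons] at h
  simp only [Multiset.singleton_inj, Multiset.singleton_eq_cons_iff, ne_eq] at h
  rcases h with ⟨h1, h2⟩ | ⟨-, cs, ⟨h1, -⟩, ⟨h2, -⟩⟩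
  · exact Or.inl ⟨h1, h2⟩
  · exact Or.inr ⟨h2.symm, h1⟩

/-- **Affine reflections preserve gaps**: if `{a + k, b + k} = {1/2 − x : x ∈ A}` and
`{a' + k', b' + k'} = {1/2 − (w₀ − x) : x ∈ A}` (the AHTW recipe at a label and — through Clozel's
purity reflection `x ↦ w₀ − x` — at the conjugate label), then `b' − a' = b − a`. [folklore] -/
theorem gap_eq_of_purity {a b k a' b' k' w₀ : ℤ} {A : Multiset ℂ} (hab : a < b) (hab' : a' < b')
    (h1 : (({a, b} : Multiset ℤ).map fun h => h + k).map (fun h : ℤ => (h : ℂ)) =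
      A.map fun x => (1 / 2 : ℂ) - x)
    (h2 : (({a', b'} : Multiset ℤ).map fun h => h + k').map (fun h : ℤ => (h : ℂ)) =
      (A.map fun x => (w₀ : ℂ) - x).map fun x => (1 / 2 : ℂ) - x) :
    b' - a' = b - a := by
  have hA : A = ((({a, b} : Multiset ℤ).map fun h => h + k).map (fun h : ℤ => (h : ℂ))).map
      fun x => (1 / 2 : ℂ) - x := by
    rw [h1, Multiset.map_map]
    conv_lhs => rw [← Multiset.map_id A]
    refine Multiset.map_congr rfl fun x _ => ?_
    simp
  rw [hA] at h2
  simp only [Multiset.insert_eq_cons, Multiset.map_cons, Multiset.map_singleton] at h2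
  rcases pair_cases h2 with ⟨e1, e2⟩ | ⟨e1, e2⟩
  · have f1 : ((a' + k' : ℤ) : ℂ) = ((1 - w₀ - b + b - a - k : ℤ) : ℂ) := by  -- = 1 - w₀ - (a + k)
      push_cast at e1 ⊢; linear_combination e1
    have f2 : ((b' + k' : ℤ) : ℂ) = ((1 - w₀ - b - k : ℤ) : ℂ) := by
      push_cast at e2 ⊢; linear_combination e2
    have g1 := Int.cast_injective f1
    have g2 := Int.cast_injective f2
    omega
  · have f1 : ((a' + k' : ℤ) : ℂ) = ((1 - w₀ - b - k : ℤ) : ℂ) := by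
      push_cast at e1 ⊢; linear_combination e1
    have f2 : ((b' + k' : ℤ) : ℂ) = ((1 - w₀ - a - k : ℤ) : ℂ) := by
      push_cast at e2 ⊢; linear_combination e2
    have g1 := Int.cast_injective f1
    have g2 := Int.cast_injective f2
    omega

/-- **A quadratic field has only two embeddings into `ℚ̄_p`**: given two distinct ones, every
embedding is one of them. [folklore] -/
theorem emb_dichotomy {F : Type} [Field F] [NumberField F] {p : ℕ} [Fact p.Prime]
    (hF2 : Module.finrank ℚ F = 2) {e₀ e₁ : F →+* PadicAlgCl p} (h01 : e₀ ≠ e₁)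
    (e : F →+* PadicAlgCl p) : e = e₀ ∨ e = e₁ := by
  by_contra hne
  push Not at hne
  have hinj : ∀ f g : F →+* PadicAlgCl p, f.toRatAlgHom = g.toRatAlgHom → f = g := fun f g hfg => by
    have := congrArg (fun φ : F →ₐ[ℚ] PadicAlgCl p => (φ : F →+* PadicAlgCl p)) hfg
    simpa using this
  have h3 : 2 < Fintype.card (F →ₐ[ℚ] PadicAlgCl p) := by
    rw [Fintype.two_lt_card_iff]
    exact ⟨e.toRatAlgHom, e₀.toRatAlgHom, e₁.toRatAlgHom, fun h => hne.1 (hinj _ _ h),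
      fun h => hne.2 (hinj _ _ h), fun h => h01 (hinj _ _ h)⟩
  rw [AlgHom.card (F := ℚ) (E := F) (PadicAlgCl p), hF2] at h3
  exact lt_irrefl _ h3

end Arithmetic

/-! ## 4. The reshaped stub (statement and proof) -/

/-- **STUB 4, RESHAPED — an automorphic algebraic twist over a CM field forces parallel gaps**, with its
in-print inputs as leading hypotheses: Harris–Lan–Taylor–Thorne Thm. A (existence of `r_ι(π)`),
A'Campo–Hevesi–Thorne–Whitmore Thm. 1.2.1 (exact labelled weights) for the pinned Fontaine data, and
the two pinned-data bookkeeping schemata (labelled weights under finite restriction, label by label;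
under twist by a de Rham character).  Clozel's purity lemma is the PROVED
`CuspidalAutomorphicRepData.purity`; Chebotarev + Brauer–Nesbitt are the PROVED
`chebotarev_artinRep_holds`, `FramedGaloisRep.nonempty_equiv_of_hasFrobCharpolyAt_eventually`.
Paper proof: `r := ρ|_{E'} ⊗ χ'` is conjugate to an HLTT-compatible `r'` (§2), whose labelled weights
at a label `(w, τ)` of `E'` are `{1/2 − a : a ∈ A(T, ι ∘ τ)}` (AHTW); at the CONJUGATE label
`(c w, τ ∘ c_w⁻¹)` the embedding is `conj ∘ (ι ∘ τ)` (`E'` CM), where purity reflects the `a`-multiset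
through `x ↦ w₀ − x`; the weights of `r` at `(w, τ)` are those of `ρ` at the label of `F` below,
shifted (§5); so the labels of `F` below `(w, τ)` and below its conjugate have EQUAL gaps and
conjugate, hence DISTINCT, global embeddings (`F` totally complex); a quadratic `F` has two embeddings
into `ℚ̄_p` and a label is determined by its embedding (§3), so every label of `F` has that gap.
No hypothesis on the splitting of `p` is used. [cite: AHTW2026, Thm. 1.2.1] [cite: Clozel1990, Lemme 4.9]
[cite: Patrikis2019, §2.7.1] -/
theorem stub_parallelOfAutomorphicTwist :
    HarrisLanTaylorThorne2016.theoremA_existence →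
    AHTW2026.labelledHodgeTateWeights_eq
      (fun (K : Type) [Field K] [NumberField K] (p : ℕ) [Fact p.Prime]
        (v : HeightOneSpectrum (𝓞 K)) (hv : ((p : ℕ) : 𝓞 K) ∈ v.asIdeal) =>
          fontainePstAdicCompletion v p hv) →
    LabelledWeightsRestrictSchema → LabelledWeightsTwistSchema →
    ∀ (F : Type) [Field F] [NumberField F] [Algebra.IsQuadraticExtension ℚ F],
    NumberField.IsTotallyComplex F → ∀ (p : ℕ) [Fact p.Prime]
    (ρ : FramedGaloisRep F (PadicAlgCl p) 2),
    HasTwoWeights F p ρ → AutomorphicTwistOverCMHT F p ρ → Parallel F p ρ := by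
  intro hA hAHTW hS1 hS2 F _ _ _ hF p _ ρ hHT hAut
  classical
  obtain ⟨E', _, _, _, hCM, χ', ι, hχ', haut⟩ := hAut
  haveI : IsCMField E' := hCM
  obtain ⟨hcpt, π, T, r', P, hT, hTreg, hss', hc', hrP⟩ :=
    Qian2022.IsAutomorphic.exists_hltt_conj hA (Or.inr hCM) haut
  obtain ⟨w₀, hw₀⟩ := π.purity hT hTreg
  -- (1) AHTW at every label of `E'`, for `r = ρ|_{E'} ⊗ χ'` (frame invariance from `r'`)
  have hHTr : ∀ (w : HeightOneSpectrum (𝓞 E')) (hw : ((p : ℕ) : 𝓞 E') ∈ w.asIdeal)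
      (τ : PinnedLabel p w hw),
      (labelledHodgeTateWeightsAtLabel (FramedRep.twist (ρ.restrictField E') χ') w hw τ).map
          (fun h : ℤ => (h : ℂ)) =
        ((T (ι.toRingHom.comp τ.emb)).map ArchWeight.a).map fun a => (1 / 2 : ℂ) - a := by
    intro w hw τ
    have h :=
      hAHTW E' hCM 2 (by norm_num) hcpt π T hT hTreg p ι r' hss' hc' w hw τ.toHom τ.continuous
    have hfr : labelledHodgeTateWeightsAtLabel (FramedRep.twist (ρ.restrictField E') χ') w hw τ =
        r'.labelledHodgeTateWeightsAt w (fontainePstAdicCompletion w p hw).algebra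
          (fontainePstAdicCompletion w p hw).𝔅 τ.toHom := by
      simp only [labelledHodgeTateWeightsAtLabel, FramedGaloisRep.labelledHodgeTateWeightsAt_def,
        hrP]
      rw [show FramedGaloisRep.toLocal w (FramedRep.conj P r') = FramedRep.conj P (r'.toLocal w)
        from FramedRep.conj_comp P r' _]
      exact PstWeilDeligneData.labelledHodgeTateWeights_conj_eq _ P _ _
    rw [hfr, h, PinnedLabel.emb, Multiset.map_map]
    refine Multiset.map_congr rfl fun x _ => ?_
    simp only [Function.comp_apply]
    norm_num
  -- (2) the weights of `r` at a label of `E'` are those of `ρ` below, shifted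
  have hbelow : ∀ (w : HeightOneSpectrum (𝓞 E')) (hw : ((p : ℕ) : 𝓞 E') ∈ w.asIdeal)
      (τ : PinnedLabel p w hw), ∃ k : ℤ,
        labelledHodgeTateWeightsAtLabel (FramedRep.twist (ρ.restrictField E') χ') w hw τ =
        (labelledHodgeTateWeightsAtLabel ρ (w.under (𝓞 F)) (natCast_mem_under (F := F) hw)
          (τ.below F)).map fun h => h + k := by
    intro w hw τ
    obtain ⟨hcr, hk⟩ := hχ' w hw
    obtain ⟨k, hk⟩ := hk τ
    exact ⟨k, labelledHodgeTateWeightsAtLabel_twist_restrictField hS1 hS2 ρ χ' τ k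
      hcr hk⟩
  -- (3) purity: the gaps below a label and below its conjugate agree
  have hconjgap : ∀ (w : HeightOneSpectrum (𝓞 E')) (hw : ((p : ℕ) : 𝓞 E') ∈ w.asIdeal)
      (τ : PinnedLabel p w hw) (a b a' b' : ℤ),
      labelledHodgeTateWeightsAtLabel ρ _ _ (τ.below F) = {a, b} → a < b →
        labelledHodgeTateWeightsAtLabel ρ _ _ (τ.conj.below F) = {a', b'} →
        a' < b' → b' - a' = b - a := by
    intro w hw τ a b a' b' h hab h' hab'
    obtain ⟨k, hk⟩ := hbelow w hw τ
    obtain ⟨k', hk'⟩ := hbelow _ _ τ.conj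
    have e1 := hHTr w hw τ
    have e2 := hHTr _ _ τ.conj
    rw [hk, h] at e1
    rw [hk', h'] at e2
    have hσ : ι.toRingHom.comp τ.conj.emb = (starRingEnd ℂ).comp (ι.toRingHom.comp τ.emb) := by
      rw [PinnedLabel.emb_conj, conj_comp_eq, RingHom.comp_assoc]
    rw [hσ, hw₀] at e2
    exact gap_eq_of_purity hab hab' e1 e2
  -- (4) one label of `E'`; the labels of `F` below it and below its conjugate
  obtain ⟨w₁, hw₁, ⟨τ₁⟩⟩ := exists_pinnedLabel E' p
  have hAB : (τ₁.below F).emb ≠ (τ₁.conj.below F).emb := by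
    rw [PinnedLabel.emb_below, PinnedLabel.emb_below, PinnedLabel.emb_conj]
    intro hEq
    haveI := hF
    obtain ⟨φ⟩ : Nonempty (E' →+* ℂ) := inferInstance
    refine IsTotallyComplex.complexEmbedding_not_isReal (φ.comp (algebraMap F E')) ?_
    rw [ComplexEmbedding.isReal_iff]
    ext x
    rw [ComplexEmbedding.conjugate_coe_eq, RingHom.comp_apply,
      ← IsCMField.complexEmbedding_complexConj E' φ]
    congr 1
    have hx := RingHom.congr_fun hEq x
    simp only [RingHom.comp_apply] at hx
    exact (τ₁.emb.injective hx).symm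
  obtain ⟨aA, bA, habA, hA'⟩ :
      ∃ a b : ℤ, a < b ∧ labelledHodgeTateWeightsAtLabel ρ _ _ (τ₁.below F) = {a, b} :=
    (hHT _ _).2 (τ₁.below F)
  obtain ⟨aB, bB, habB, hB'⟩ :
      ∃ a b : ℤ, a < b ∧ labelledHodgeTateWeightsAtLabel ρ _ _ (τ₁.conj.below F) = {a, b} :=
    (hHT _ _).2 (τ₁.conj.below F)
  have hgapAB : bB - aB = bA - aA := hconjgap w₁ hw₁ τ₁ aA bA aB bB hA' habA hB' habB
  -- (5) every label of `F` is one of these two (two embeddings; rigidity), so has gap `bA - aA`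
  have hF2 : Module.finrank ℚ F = 2 := Algebra.IsQuadraticExtension.finrank_eq_two ℚ F
  have key : ∀ (v : HeightOneSpectrum (𝓞 F)) (hv : ((p : ℕ) : 𝓞 F) ∈ v.asIdeal)
      (τ : PinnedLabel p v hv) (a b : ℤ),
      labelledHodgeTateWeightsAtLabel ρ v hv τ = {a, b} → a < b → b - a = bA - aA := by
    intro v hv τ a b h hab
    rcases emb_dichotomy hF2 hAB τ.emb with he | he
    · rw [labelledHodgeTateWeightsAtLabel_eq_of_emb_eq ρ τ (τ₁.below F) he, hA'] at h
      rcases Theorems.NonParallelVoid.pair_eq_pair_iff.1 h with ⟨h1, h2⟩ | ⟨h1, h2⟩ <;> omega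
    · rw [labelledHodgeTateWeightsAtLabel_eq_of_emb_eq ρ τ (τ₁.conj.below F) he, hB'] at h
      rcases Theorems.NonParallelVoid.pair_eq_pair_iff.1 h with ⟨h1, h2⟩ | ⟨h1, h2⟩ <;> omega
  obtain ⟨g, hg⟩ := Theorems.NonParallelVoid.exists_common_gap_of_forall_gap_eq
    (fun v hv (τ : PinnedLabel p v hv) => labelledHodgeTateWeightsAtLabel ρ v hv τ)
    (fun v hv τ => (hHT v hv).2 τ)
    (fun v hv τ v' hv' τ' a b a' b' h hab h' hab' => by
      rw [key v hv τ a b h hab, key v' hv' τ' a' b' h' hab'])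
  exact ⟨g, fun v hv τ => hg v hv τ⟩

end Summit.Langlands.Langlands.Cruxes.TwistedInductionParallel.SymmetrisePdSplit
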